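import Summits.Ventures.PercRepro2.TypedCountCertificate

/-!
# The contracted-source family of the typed count is false with the split point in the source block
(blind cell PercRepro2, night-3 g25, 2026-08-29; `proofs/NIGHT3-CERT.md` §34.2)

For a partition `𝒫` of the vertices with `s`-block `S₀`, the **contracted-source count** is
`T(H, 𝒫) := Σ_{A : v ∈ R_s(A)} (f(R_𝒫(A)) − f(B_𝒫(A)))·(g(R_𝒫(A)) − g(B_𝒫(A)))`, where `R_𝒫 / B_𝒫` are
the red / blue clusters of the merged block `S₀` in `H/𝒫` and the weight is the UNMERGED red cluster of
`s` in `H` (§34.2; `𝒫` discrete gives the typed count `Tform`).  It is the object an edge-induction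
on `T` produces (`T(H,𝒫) − T(H−e,𝒫) = T(H−e, 𝒫∨e) + Box + S2`), exhaustively nonnegative at
`n ≤ 4, m ≤ 5` whenever `v ∉ S₀`, and **false when `v ∈ S₀`**: on the 4-cycle `s–d₁–v–d₂–s` with
`{s, v}` merged and `f = [d₁ ∈ ·]`, `g = [d₂ ∈ ·]` the count is `−1` (the weight `[v ∈ R_s]` is the
disjunction of the two routes `s–d₁–v`, `s–d₂–v`; the merged clusters are the coin unions).  So an
edge joining the source block to `v` is never a safe step of the induction.  Own work; standard axioms.
-/

namespace Summit.Ventures.PercRepro2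

namespace TypedCert

/-- One closure round with blocks: a red edge with an endpoint in `C` adds the whole blocks of both
endpoints (`blocks` = the masks of the blocks of the partition; a vertex in no listed block is its own
block). -/
def closeStepP (edges : Edges) (blocks : List Nat) (A : Nat) (C : Nat) : Nat :=
  (List.range edges.length).foldl
    (fun C' i =>
      match edges[i]? with
      | some (a, b) =>
        if A.testBit i && (C'.testBit a || C'.testBit b) then
          C' ||| blockOf blocks a ||| blockOf blocks b
        else C'
      | none => C') C
where
  /-- the block of a vertex: the first listed block containing it, else the singleton. -/
  blockOf (blocks : List Nat) (x : Nat) : Nat :=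
    match blocks.find? (fun B => B.testBit x) with
    | some B => B
    | none => 1 <<< x

/-- The cluster of the block of `s` in `H/𝒫`, as a vertex mask of `V`. -/
def clusterMaskP (edges : Edges) (blocks : List Nat) (A : Nat) (s : Nat) : Nat :=
  Nat.iterate (closeStepP edges blocks A) edges.length (closeStepP.blockOf blocks s)

/-- The contracted-source count `T(H, 𝒫)` in the bitmask model: the weight is the unmerged red
cluster of `s`, the clusters are those of the merged block. -/
def TformP {R : Type*} [CommRing R] (edges : Edges) (blocks : List Nat) (s v : Nat)
    (f g : Nat → R) : R :=
  ((List.range (1 <<< edges.length)).map (fun A =>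
    let Rm := clusterMaskP edges blocks A s
    let Bm := clusterMaskP edges blocks (flipMask edges.length A) s
    if (clusterMask edges A s).testBit v then (f Rm - f Bm) * (g Rm - g Bm) else 0)).sum

/-- The indicator of «vertex `x` belongs to the set» is mask-monotone. -/
lemma monoMask_indicator {R : Type*} [Field R] [LinearOrder R] [IsStrictOrderedRing R] (x : Nat) :
    MonoMask (fun X : Nat => if X.testBit x then (1 : R) else 0) := by
  intro X Y h
  simp only
  by_cases hX : X.testBit x
  · have hY : Y.testBit x = true := by
      have := congrArg (fun Z => Z.testBit x) h
      simp only [Nat.testBit_land] at this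
      rw [hX] at this
      simpa using this.symm
    simp [hX, hY]
  · simp only [hX, Bool.false_eq_true, if_false]
    split_ifs <;> norm_num

/-- **The witness**: the 4-cycle `0–2–1–3–0` (`s = 0`, `v = 1`, `d₁ = 2`, `d₂ = 3`) with the block
`{0, 1}` merged, `f = [2 ∈ ·]`, `g = [3 ∈ ·]`: the contracted-source count equals `−1`. -/
theorem TformP_fourCycle_eq_neg_one :
    TformP [(0, 2), (2, 1), (0, 3), (3, 1)] [3] 0 1
      (fun X : Nat => if X.testBit 2 then (1 : ℚ) else 0)
      (fun X : Nat => if X.testBit 3 then (1 : ℚ) else 0) = -1 := by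
  decide +kernel

/-- **The contracted-source family is not nonnegative when `v` lies in the source block**: there are
mask-monotone `f, g` with `T(H, 𝒫) < 0`. -/
theorem exists_contracted_neg :
    ∃ f g : Nat → ℚ, MonoMask f ∧ MonoMask g ∧
      TformP [(0, 2), (2, 1), (0, 3), (3, 1)] [3] 0 1 f g < 0 :=
  ⟨_, _, monoMask_indicator 2, monoMask_indicator 3, by rw [TformP_fourCycle_eq_neg_one]; norm_num⟩

/-! ## The family fails even with `v` outside the source block (`n = 5`)
(§34.9: found by the tensor-cone census j323846 and the all-up-set check exh5fam.c) -/

/-- **The `n = 5` witness**: edges `(0,3) (0,4) (1,2) (2,3) (2,4)`, `s = 0`, `v = 1`, blocks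
`{0, 2}, {1}, {3}, {4}` (so `v` is NOT in the source block), `f = [{0,2,4} ⊆ ·]`,
`g = [{0,2,3} ⊆ ·]`: the contracted-source count equals `−1` (the plain typed count is `3`). -/
theorem TformP_fiveVertex_eq_neg_one :
    TformP [(0, 3), (0, 4), (1, 2), (2, 3), (2, 4)] [5] 0 1
      (fun X : Nat => if X &&& 21 = 21 then (1 : ℚ) else 0)
      (fun X : Nat => if X &&& 13 = 13 then (1 : ℚ) else 0) = -1 := by
  decide +kernel

/-- The indicator of «the set contains the mask `U`» is mask-monotone. -/
lemma monoMask_indicator_subset {R : Type*} [Field R] [LinearOrder R] [IsStrictOrderedRing R]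
    (U : Nat) : MonoMask (fun X : Nat => if X &&& U = U then (1 : R) else 0) := by
  intro X Y h
  simp only
  by_cases hX : X &&& U = U
  · have hY : Y &&& U = U := by
      have h1 : X &&& Y = X := h
      calc Y &&& U = Y &&& (X &&& U) := by rw [hX]
        _ = (Y &&& X) &&& U := by rw [Nat.land_assoc]
        _ = (X &&& Y) &&& U := by rw [Nat.land_comm Y X]
        _ = X &&& U := by rw [h1]
        _ = U := hX
    simp [hX, hY]
  · simp only [hX, if_false]
    split_ifs <;> norm_num

/-- **The contracted-source family is not nonnegative even when `v` is outside the source block**: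
at `n = 5` there are mask-monotone `f, g` with `T(H, 𝒫) < 0`. -/
theorem exists_contracted_neg_v_outside :
    ∃ f g : Nat → ℚ, MonoMask f ∧ MonoMask g ∧
      TformP [(0, 3), (0, 4), (1, 2), (2, 3), (2, 4)] [5] 0 1 f g < 0 :=
  ⟨_, _, monoMask_indicator_subset 21, monoMask_indicator_subset 13, by
    rw [TformP_fiveVertex_eq_neg_one]; norm_num⟩

end TypedCert

end Summit.Ventures.PercRepro2
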